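import Summits.AtomisticToContinuum.FouriersLaw.Theorems.HiddenChargeMazurOddChargeAlgebraDefs

/-!
# Odd conservation laws of the pinned anharmonic chain — the left-aligned normal form `N`

Monomial bookkeeping (`msites`, `minsite`, `maxsite`, translations `transl k`), the left-aligned
representative `nfMon`, and the linear normal form `nf` (`N`) of the chain algebra
`𝓡 = ℝ[q_x, p_x : x ∈ ℤ]`: `N ∘ S = N`, `N (f - S f) = 0`, `N ∘ N = N`, `f - N f ∈ (1 - S)𝓡` with
support control, compatibility of `N` with the weight gradings and with momentum reversal, and the
class projections `projSD`. [folklore]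
-/

noncomputable section

open MvPolynomial Finsupp
open scoped BigOperators

namespace Summit.AtomisticToContinuum.FouriersLaw.Theorems.OddChargeAlgebra

/-! ## The monomial lift -/

/-- `liftMon φ` on a monomial. [folklore] -/
@[simp] theorem liftMon_monomial (φ : (Var →₀ ℕ) → R) (m : Var →₀ ℕ) (c : ℝ) :
    liftMon φ (monomial m c) = c • φ m := by
  simp [liftMon, monomial]

/-! ## Translations -/

/-- Sites are translated by `transl`. [folklore] -/
@[simp] theorem site_transl (k : ℤ) (v : Var) : Var.site (transl k v) = Var.site v + k := by
  cases v <;> rfl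

/-- The momentum weight is translation invariant. [folklore] -/
@[simp] theorem pwt_transl (k : ℤ) (v : Var) : pwt (transl k v) = pwt v := by
  cases v <;> rfl

/-- The weight is translation invariant. [folklore] -/
@[simp] theorem wt_transl (k : ℤ) (v : Var) : wt (transl k v) = wt v := by
  cases v <;> rfl

/-- Translations compose additively. [folklore] -/
@[simp] theorem transl_transl (j k : ℤ) (v : Var) : transl k (transl j v) = transl (j + k) v := by
  cases v <;> simp [transl, add_assoc]

/-- Translation by `0` is the identity. [folklore] -/
@[simp] theorem transl_zero (v : Var) : transl 0 v = v := by
  cases v <;> simp [transl]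

/-- Translations are injective. [folklore] -/
theorem transl_injective (k : ℤ) : Function.Injective (transl k) := by
  intro v w h
  simpa using congrArg (transl (-k)) h

/-- Iterated translation of exponent vectors. [folklore] -/
@[simp] theorem mapDomain_transl_transl (j k : ℤ) (m : Var →₀ ℕ) :
    mapDomain (transl k) (mapDomain (transl j) m) = mapDomain (transl (j + k)) m := by
  rw [← Finsupp.mapDomain_comp]
  exact congrFun (congrArg mapDomain (funext fun v => transl_transl j k v)) m

/-- Translation of exponent vectors by `0`. [folklore] -/
@[simp] theorem mapDomain_transl_zero (m : Var →₀ ℕ) : mapDomain (transl 0) m = m := by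
  have h : transl 0 = id := funext transl_zero
  rw [h, Finsupp.mapDomain_id]

/-- Support of a translated exponent vector. [folklore] -/
theorem support_mapDomain_transl (k : ℤ) (m : Var →₀ ℕ) :
    (mapDomain (transl k) m).support = m.support.image (transl k) := by
  classical
  exact Finsupp.mapDomain_support_of_injective (transl_injective k) m

/-- Exponents of a translated exponent vector. [folklore] -/
@[simp] theorem mapDomain_transl_apply (k : ℤ) (m : Var →₀ ℕ) (v : Var) :
    mapDomain (transl k) m (transl k v) = m v :=
  Finsupp.mapDomain_apply (transl_injective k) m v

/-- A translation-invariant weight is invariant under translation of exponent vectors. [folklore] -/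
theorem weight_mapDomain_transl {w : Var → ℕ} {k : ℤ} (hw : ∀ v, w (transl k v) = w v)
    (m : Var →₀ ℕ) :
    weight w (mapDomain (transl k) m) = weight w m := by
  simp only [weight_apply]
  rw [Finsupp.sum_mapDomain_index_inj (transl_injective k)]
  simp [hw]

/-- The momentum degree is translation invariant. [folklore] -/
@[simp] theorem weight_pwt_mapDomain_transl (k : ℤ) (m : Var →₀ ℕ) :
    weight pwt (mapDomain (transl k) m) = weight pwt m :=
  weight_mapDomain_transl (pwt_transl k) m

/-- The weight is translation invariant. [folklore] -/
@[simp] theorem weight_wt_mapDomain_transl (k : ℤ) (m : Var →₀ ℕ) :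
    weight wt (mapDomain (transl k) m) = weight wt m :=
  weight_mapDomain_transl (wt_transl k) m

/-! ## Sites of a monomial -/

/-- Membership in `msites`. [folklore] -/
theorem mem_msites {m : Var →₀ ℕ} {x : ℤ} : x ∈ msites m ↔ ∃ v ∈ m.support, Var.site v = x := by
  simp [msites]

/-- `msites m` is nonempty iff `m ≠ 0`. [folklore] -/
theorem msites_nonempty_iff {m : Var →₀ ℕ} : (msites m).Nonempty ↔ m ≠ 0 := by
  simp [msites, Finset.image_nonempty, Finsupp.support_nonempty_iff]

/-- The constant monomial has no sites. [folklore] -/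
@[simp] theorem msites_zero : msites 0 = ∅ := by simp [msites]

/-- `minsite 0 = 0`. [folklore] -/
@[simp] theorem minsite_zero : minsite 0 = 0 := by simp [minsite]

/-- `maxsite 0 = 0`. [folklore] -/
@[simp] theorem maxsite_zero : maxsite 0 = 0 := by simp [maxsite]

/-- Every variable of a monomial sits at a site `≥ minsite`. [folklore] -/
theorem minsite_le_site {m : Var →₀ ℕ} {v : Var} (hv : v ∈ m.support) : minsite m ≤ Var.site v := by
  have hx : Var.site v ∈ msites m := mem_msites.mpr ⟨v, hv, rfl⟩
  rw [minsite, dif_pos ⟨_, hx⟩]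
  exact Finset.min'_le _ _ hx

/-- Every variable of a monomial sits at a site `≤ maxsite`. [folklore] -/
theorem site_le_maxsite {m : Var →₀ ℕ} {v : Var} (hv : v ∈ m.support) : Var.site v ≤ maxsite m := by
  have hx : Var.site v ∈ msites m := mem_msites.mpr ⟨v, hv, rfl⟩
  rw [maxsite, dif_pos ⟨_, hx⟩]
  exact Finset.le_max' _ _ hx

/-- The minimal site is attained. [folklore] -/
theorem exists_site_eq_minsite {m : Var →₀ ℕ} (hm : m ≠ 0) :
    ∃ v ∈ m.support, Var.site v = minsite m := by
  have h : (msites m).Nonempty := msites_nonempty_iff.mpr hm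
  rw [minsite, dif_pos h]
  exact mem_msites.mp (Finset.min'_mem _ h)

/-- The maximal site is attained. [folklore] -/
theorem exists_site_eq_maxsite {m : Var →₀ ℕ} (hm : m ≠ 0) :
    ∃ v ∈ m.support, Var.site v = maxsite m := by
  have h : (msites m).Nonempty := msites_nonempty_iff.mpr hm
  rw [maxsite, dif_pos h]
  exact mem_msites.mp (Finset.max'_mem _ h)

/-- `minsite ≤ maxsite`. [folklore] -/
theorem minsite_le_maxsite (m : Var →₀ ℕ) : minsite m ≤ maxsite m := by
  by_cases hm : m = 0
  · simp [hm]
  · obtain ⟨v, hv, hv'⟩ := exists_site_eq_minsite hm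
    exact hv' ▸ site_le_maxsite hv

/-- Characterisation of `minsite` by a witness and a bound. [folklore] -/
theorem minsite_eq_of {m : Var →₀ ℕ} {k : ℤ} (h1 : ∃ v ∈ m.support, Var.site v = k)
    (h2 : ∀ v ∈ m.support, k ≤ Var.site v) : minsite m = k := by
  obtain ⟨v, hv, rfl⟩ := h1
  have hm : m ≠ 0 := by rintro rfl; simp at hv
  obtain ⟨w, hw, hw'⟩ := exists_site_eq_minsite hm
  exact le_antisymm (minsite_le_site hv) (hw' ▸ h2 w hw)

/-- Characterisation of `maxsite` by a witness and a bound. [folklore] -/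
theorem maxsite_eq_of {m : Var →₀ ℕ} {k : ℤ} (h1 : ∃ v ∈ m.support, Var.site v = k)
    (h2 : ∀ v ∈ m.support, Var.site v ≤ k) : maxsite m = k := by
  obtain ⟨v, hv, rfl⟩ := h1
  have hm : m ≠ 0 := by rintro rfl; simp at hv
  obtain ⟨w, hw, hw'⟩ := exists_site_eq_maxsite hm
  exact le_antisymm (hw' ▸ h2 w hw) (site_le_maxsite hv)

/-- Sites of a translated monomial. [folklore] -/
theorem msites_mapDomain_transl (k : ℤ) (m : Var →₀ ℕ) :
    msites (mapDomain (transl k) m) = (msites m).image (· + k) := by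
  simp only [msites, support_mapDomain_transl, Finset.image_image]
  exact congrArg (Finset.image · m.support) (funext fun v => site_transl k v)

/-- Minimal site of a translated monomial. [folklore] -/
theorem minsite_mapDomain_transl {m : Var →₀ ℕ} (hm : m ≠ 0) (k : ℤ) :
    minsite (mapDomain (transl k) m) = minsite m + k := by
  obtain ⟨v, hv, hv'⟩ := exists_site_eq_minsite hm
  refine minsite_eq_of ⟨transl k v, ?_, by simp [hv']⟩ fun w hw => ?_
  · rw [support_mapDomain_transl]; exact Finset.mem_image_of_mem _ hv
  · rw [support_mapDomain_transl, Finset.mem_image] at hw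
    obtain ⟨u, hu, rfl⟩ := hw
    simpa using minsite_le_site hu

/-- Maximal site of a translated monomial. [folklore] -/
theorem maxsite_mapDomain_transl {m : Var →₀ ℕ} (hm : m ≠ 0) (k : ℤ) :
    maxsite (mapDomain (transl k) m) = maxsite m + k := by
  obtain ⟨v, hv, hv'⟩ := exists_site_eq_maxsite hm
  refine maxsite_eq_of ⟨transl k v, ?_, by simp [hv']⟩ fun w hw => ?_
  · rw [support_mapDomain_transl]; exact Finset.mem_image_of_mem _ hv
  · rw [support_mapDomain_transl, Finset.mem_image] at hw
    obtain ⟨u, hu, rfl⟩ := hw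
    simpa using site_le_maxsite hu

/-! ## The left-aligned representative `nfMon` -/

/-- `nfMon 0 = 0`. [folklore] -/
@[simp] theorem nfMon_zero : nfMon 0 = 0 := by simp [nfMon]

/-- `nfMon m = 0 ↔ m = 0`. [folklore] -/
theorem nfMon_eq_zero_iff {m : Var →₀ ℕ} : nfMon m = 0 ↔ m = 0 := by
  refine ⟨fun h => ?_, fun h => by simp [h]⟩
  have h' : mapDomain (transl (-minsite m)) m = mapDomain (transl (-minsite m)) 0 := by
    rw [Finsupp.mapDomain_zero]; exact h
  exact Finsupp.mapDomain_injective (transl_injective _) h'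

/-- The left-aligned representative has minimal site `0`. [folklore] -/
theorem minsite_nfMon {m : Var →₀ ℕ} (hm : m ≠ 0) : minsite (nfMon m) = 0 := by
  rw [nfMon, minsite_mapDomain_transl hm]; ring

/-- The span of the left-aligned representative. [folklore] -/
theorem maxsite_nfMon {m : Var →₀ ℕ} (hm : m ≠ 0) : maxsite (nfMon m) = maxsite m - minsite m := by
  rw [nfMon, maxsite_mapDomain_transl hm]; ring

/-- `nfMon` is translation invariant. [folklore] -/
@[simp] theorem nfMon_mapDomain_transl (k : ℤ) (m : Var →₀ ℕ) :
    nfMon (mapDomain (transl k) m) = nfMon m := by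
  by_cases hm : m = 0
  · simp [hm, Finsupp.mapDomain_zero]
  rw [nfMon, minsite_mapDomain_transl hm, mapDomain_transl_transl, nfMon]
  congr 2; ring

/-- Left-aligned monomials are their own representatives. [folklore] -/
theorem nfMon_eq_self {m : Var →₀ ℕ} (h : m = 0 ∨ minsite m = 0) : nfMon m = m := by
  rcases h with rfl | h
  · simp
  · simp [nfMon, h]

/-- `nfMon` is idempotent. [folklore] -/
@[simp] theorem nfMon_nfMon (m : Var →₀ ℕ) : nfMon (nfMon m) = nfMon m :=
  nfMon_mapDomain_transl _ _

/-- `nfMon` preserves the momentum degree. [folklore] -/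
@[simp] theorem weight_pwt_nfMon (m : Var →₀ ℕ) : weight pwt (nfMon m) = weight pwt m :=
  weight_pwt_mapDomain_transl _ _

/-- `nfMon` preserves the weight. [folklore] -/
@[simp] theorem weight_wt_nfMon (m : Var →₀ ℕ) : weight wt (nfMon m) = weight wt m :=
  weight_wt_mapDomain_transl _ _

/-! ## The normal form `N` -/

/-- `N` on a monomial. [folklore] -/
@[simp] theorem nf_monomial (m : Var →₀ ℕ) (c : ℝ) : nf (monomial m c) = monomial (nfMon m) c := by
  rw [nf, liftMon_monomial, smul_monomial, smul_eq_mul, mul_one]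

/-- `N` fixes constants. [folklore] -/
@[simp] theorem nf_C (c : ℝ) : nf (C c : R) = C c := by
  rw [C_apply, nf_monomial, nfMon_zero]

/-- `N f` as a sum over the support of `f`. [folklore] -/
theorem nf_apply (f : R) : nf f = ∑ m ∈ f.support, monomial (nfMon m) (f.coeff m) := by
  conv_lhs => rw [f.as_sum]
  rw [map_sum]
  exact Finset.sum_congr rfl fun m _ => nf_monomial _ _

/-- The coefficients of `N f` are the `S`-orbit sums of the coefficients of `f`. [folklore] -/
theorem coeff_nf (f : R) (n : Var →₀ ℕ) :
    (nf f).coeff n = ∑ m ∈ f.support with nfMon m = n, f.coeff m := by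
  classical
  rw [nf_apply, coeff_sum, Finset.sum_filter]
  exact Finset.sum_congr rfl fun m _ => by rw [coeff_monomial]

/-- The support of `N f`. [folklore] -/
theorem support_nf_subset (f : R) : (nf f).support ⊆ f.support.image nfMon := by
  classical
  intro n hn
  rw [MvPolynomial.mem_support_iff, coeff_nf] at hn
  obtain ⟨m, hm, -⟩ := Finset.exists_ne_zero_of_sum_ne_zero hn
  rw [Finset.mem_filter] at hm
  exact Finset.mem_image.mpr ⟨m, hm.1, hm.2⟩

/-- `shiftBy k` on a monomial. [folklore] -/
theorem shiftBy_monomial (k : ℤ) (m : Var →₀ ℕ) (c : ℝ) :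
    shiftBy k (monomial m c) = monomial (mapDomain (transl k) m) c :=
  rename_monomial _ _ _

/-- `shift` on a monomial. [folklore] -/
theorem shift_monomial (m : Var →₀ ℕ) (c : ℝ) :
    shift (monomial m c) = monomial (mapDomain (transl 1) m) c :=
  rename_monomial _ _ _

/-- (C₁) `N ∘ S^k = N`. [folklore] -/
@[simp] theorem nf_shiftBy (k : ℤ) (f : R) : nf (shiftBy k f) = nf f := by
  induction f using MvPolynomial.induction_on' with
  | monomial m c => rw [shiftBy_monomial, nf_monomial, nf_monomial, nfMon_mapDomain_transl]
  | add p q hp hq => rw [map_add, map_add, hp, hq, map_add]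

/-- (C₁) `N ∘ S = N`. [folklore] -/
@[simp] theorem nf_shift (f : R) : nf (shift f) = nf f := nf_shiftBy 1 f

/-- (C₁) `N` kills the shift-coboundaries `(1 - S)𝓡`. [folklore] -/
theorem nf_sub_shift : ∀ f : R, nf (f - shift f) = 0 := by
  intro f
  rw [map_sub, nf_shift, sub_self]

/-- `N` is idempotent. [folklore] -/
@[simp] theorem nf_nf (f : R) : nf (nf f) = nf f := by
  induction f using MvPolynomial.induction_on' with
  | monomial m c => rw [nf_monomial, nf_monomial, nfMon_nfMon]
  | add p q hp hq => rw [map_add, map_add, hp, hq]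

/-- A polynomial all of whose monomials are left-aligned is `N`-invariant. [folklore] -/
theorem nf_eq_self_of {f : R} (h : ∀ m ∈ f.support, m = 0 ∨ minsite m = 0) : nf f = f := by
  rw [nf_apply]
  conv_rhs => rw [f.as_sum]
  exact Finset.sum_congr rfl fun m hm => by rw [nfMon_eq_self (h m hm)]

/-- The monomials of an `N`-invariant polynomial are left-aligned. [folklore] -/
theorem minsite_eq_zero_of_nf_eq_self {f : R} (h : nf f = f) {m : Var →₀ ℕ} (hm : m ∈ f.support)
    (hm0 : m ≠ 0) : minsite m = 0 := by
  rw [← h] at hm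
  obtain ⟨m', -, rfl⟩ := Finset.mem_image.mp (support_nf_subset f hm)
  exact minsite_nfMon fun h' => hm0 (by rw [h', nfMon_zero])

/-- Left-alignedness in the `↔` form. [folklore] -/
theorem nf_eq_self_iff {f : R} : nf f = f ↔ ∀ m ∈ f.support, m = 0 ∨ minsite m = 0 :=
  ⟨fun h _ hm => or_iff_not_imp_left.mpr (minsite_eq_zero_of_nf_eq_self h hm), nf_eq_self_of⟩

/-! ## Site support of polynomials -/

/-- Sites of the variables of a polynomial supported on `Var.site ⁻¹' S`. [folklore] -/
theorem site_mem_of_mem_supported {S : Set ℤ} {f : R} (hf : f ∈ supported ℝ (Var.site ⁻¹' S))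
    {m : Var →₀ ℕ} (hm : m ∈ f.support) {v : Var} (hv : v ∈ m.support) : Var.site v ∈ S := by
  rw [MvPolynomial.mem_supported] at hf
  exact hf ((mem_vars_iff_mem_support v).mpr ⟨m, hm, hv⟩)

/-- A polynomial whose monomials only involve sites in `S` is supported on `Var.site ⁻¹' S`. [folklore] -/
theorem mem_supported_of_site_mem {S : Set ℤ} {f : R}
    (h : ∀ m ∈ f.support, ∀ v ∈ m.support, Var.site v ∈ S) : f ∈ supported ℝ (Var.site ⁻¹' S) := by
  rw [MvPolynomial.mem_supported]
  intro v hv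
  obtain ⟨m, hm, hv⟩ := (mem_vars_iff_mem_support v).mp hv
  exact h m hm v hv

/-- A monomial whose sites lie in `S` is supported on `Var.site ⁻¹' S`. [folklore] -/
theorem monomial_mem_supported {S : Set ℤ} {m : Var →₀ ℕ} (h : ∀ v ∈ m.support, Var.site v ∈ S)
    (c : ℝ) : monomial m c ∈ supported ℝ (Var.site ⁻¹' S) := by
  classical
  refine mem_supported_of_site_mem fun n hn v hv => h v ?_
  have := support_monomial_subset hn
  rw [Finset.mem_singleton] at this
  exact this ▸ hv

/-- (C₂) on a monomial with sites in `[0, M]`: `m - N m = χ - S χ` with `χ` on sites `[0, M-1]`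
(telescoping `1 - S^{-k} = (1 - S)(-S^{-1} - ⋯ - S^{-k})`, `k = minsite m`). [folklore] -/
theorem exists_sub_nf_monomial (M : ℕ) (m : Var →₀ ℕ)
    (hm : ∀ v ∈ m.support, Var.site v ∈ Set.Icc (0 : ℤ) M) (c : ℝ) :
    ∃ χ : R, χ ∈ supported ℝ (Var.site ⁻¹' Set.Icc (0 : ℤ) ((M : ℤ) - 1)) ∧
      monomial m c - nf (monomial m c) = χ - shift χ := by
  -- `T j = S^{-j} (monomial m c)`; `χ = -∑_{j<k} T (j+1)`.
  set T : ℕ → R := fun j => shiftBy (-(j : ℤ)) (monomial m c) with hT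
  have hk : 0 ≤ minsite m := by
    by_cases h0 : m = 0
    · simp [h0]
    · obtain ⟨v, hv, hv'⟩ := exists_site_eq_minsite h0
      exact hv' ▸ (hm v hv).1
  obtain ⟨k, hk'⟩ : ∃ k : ℕ, minsite m = k := ⟨(minsite m).toNat, (Int.toNat_of_nonneg hk).symm⟩
  refine ⟨-∑ j ∈ Finset.range k, T (j + 1), ?_, ?_⟩
  · refine Subalgebra.neg_mem _ (Subalgebra.sum_mem _ fun j hj => ?_)
    rw [Finset.mem_range] at hj
    simp only [hT, shiftBy_monomial]
    refine monomial_mem_supported (fun v hv => ?_) c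
    rw [support_mapDomain_transl, Finset.mem_image] at hv
    obtain ⟨u, hu, rfl⟩ := hv
    have h1 := hm u hu
    have h2 := minsite_le_site hu
    simp only [Set.mem_Icc, site_transl] at h1 ⊢
    constructor <;> push_cast <;> omega
  · have hshift : ∀ j : ℕ, shift (T (j + 1)) = T j := fun j => by
      simp only [hT, shiftBy_monomial, shift_monomial, mapDomain_transl_transl]
      rw [show -((j + 1 : ℕ) : ℤ) + 1 = -(j : ℤ) by push_cast; ring]
    have h0 : T 0 = monomial m c := by
      simp only [hT, shiftBy_monomial, Nat.cast_zero, neg_zero, mapDomain_transl_zero]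
    have hkT : T k = nf (monomial m c) := by
      simp only [hT, shiftBy_monomial, nf_monomial, nfMon, hk']
    rw [← hkT, ← h0, map_neg, map_sum, neg_sub_neg]
    simp only [hshift]
    exact (Finset.sum_range_sub' T k).symm.trans (by rw [Finset.sum_sub_distrib])

/-- (C₂) `f - N f ∈ (1 - S)𝓡`, with support control: if `f` lives on the sites `[0, M]` then
`f - N f = χ - S χ` with `χ` on the sites `[0, M - 1]`. [folklore] -/
theorem exists_sub_nf : ∀ (M : ℕ) (f : R), f ∈ supported ℝ (Var.site ⁻¹' Set.Icc (0 : ℤ) M) →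
    ∃ χ : R, χ ∈ supported ℝ (Var.site ⁻¹' Set.Icc (0 : ℤ) ((M : ℤ) - 1)) ∧
      f - nf f = χ - shift χ := by
  intro M f hf
  choose χ hχ hχ' using fun m (hm : m ∈ f.support) =>
    exists_sub_nf_monomial M m (fun v hv => site_mem_of_mem_supported hf hm hv) (f.coeff m)
  refine ⟨∑ m ∈ f.support.attach, χ m.1 m.2, Subalgebra.sum_mem _ fun m _ => hχ m.1 m.2, ?_⟩
  rw [map_sum, ← Finset.sum_sub_distrib, ← Finset.sum_congr rfl fun m _ => hχ' m.1 m.2,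
    Finset.sum_sub_distrib, Finset.sum_attach _ fun m => monomial m (f.coeff m),
    Finset.sum_attach _ fun m => nf (monomial m (f.coeff m)), ← map_sum, ← f.as_sum]

end Summit.AtomisticToContinuum.FouriersLaw.Theorems.OddChargeAlgebra

end
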